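import Summits.BirchSwinnertonDyer.Rank1Residual.X11a.RankZeroHeightFree
import Literature.NumberTheory.EllipticCurves.Rank1Residual.Typed.X11HidaTransfer
import HarnessLib

/-!
# Rank `0` at a multiplicative prime: the remaining rank-`0` consumers of Stein–Wuthrich Thm. 6.1
# (Skinner Thm. A ⇒ Thm. C; the Emerton–Pollack–Weston weight-2 transfer `X11RankZero.*`), height-free
# (cell `b2b-bsdres`, unit `b2b-bsdres-x11a`, gen 18)

HONEST FRAMING (run/shared/lean/b2b/bsd-rank1-residual/, verbatim in every file): the goal of the
cell is to DELETE the COMBINATION-SHAPED residual classes of the Birch–Swinnerton-Dyer formula for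
ALL analytic-rank `≤ 1` elliptic curves over `ℚ` — "full BSD formula for every rank `≤ 1` curve in
class `C`" assembled STRICTLY from published theorems — so that the rank-`≤ 1` remainder becomes
exactly the CONSTRUCTION-SHAPED classes, which are TYPED (missing-input `Prop`s), NOT attempted.
This is not "finishing BSD". Research route; NO CLAIM BEYOND STATED CLASSES. No label change is
made by this file (cell lead / referee).

Height-free twins (`…_heightFree`, binder `hH : SteinWuthrich2013.exists_is{Split,}MultCanonical`
GONE — at analytic rank `0` THE §4.2 datum is the zero pairing, `X11a/RankZeroHeightFree.lean`,
p225969) of the rank-`0` consumers of x11a gen 8 that live in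
`Literature/…/Rank1Residual/Typed/MultiplicativeRankZero.lean` and `Typed/X11HidaTransfer.lean`:

* `bsdp_of_thmA_{nonsplit,split}_rankZero_heightFree` — the multiplicative rank-`0` half of Skinner
  2016 Thm. C DERIVED in the kernel from his Thm. A (`hA`, (irr) + (ram), `p ≥ 3`) + Stein–Wuthrich
  Thm. 6.1 + Greenberg–Stevens + GZK + modularity, now with no height-existence fact;
* `X11RankZero.bsdp_of_multCharIdealMuZero_{nonsplit,split}_heightFree`,
  `X11RankZero.missingInputAt_of_multCharIdealMuZero_{nonsplit,split}_heightFree`,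
  `X11RankZero.bsdp_of_transfer_{goodOrdinary,multiplicative}_{nonsplit,split}_heightFree` — the
  Emerton–Pollack–Weston Cor. 5.1.4 weight-2 partner route (`EmertonPollackWeston2006/HidaFamilyTransfer.lean`).

Proofs adapted verbatim (one-line re-pointing to the height-free glue). New declarations live in
`Summit.BirchSwinnertonDyer.Rank1Residual.RankZeroHeightFree` (Summits placement rule); the
originals are unchanged.
-- adapted from Literature/NumberTheory/EllipticCurves/Rank1Residual/Typed/{MultiplicativeRankZero,X11HidaTransfer}.lean

References: Skinner 2016 Thm. A/C, §3.2–3.3 [Skinner2016PacificMC]; Emerton–Pollack–Weston 2006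
Cor. 5.1.4 [EmertonPollackWeston2006]; Stein–Wuthrich 2013 Thm. 6.1, §4.2 [SteinWuthrich2013];
Greenberg–Stevens 1993 [GreenbergStevens1993]; Miller 2011 Def. 1.1 [Miller2011LMS].
-/

set_option autoImplicit false

noncomputable section

open scoped Classical MatrixGroups ModularForm

open CongruenceSubgroup WeierstrassCurve Literature.NumberTheory.EllipticCurves
  Literature.NumberTheory.EllipticCurves.ModularForms
  Literature.NumberTheory.EllipticCurves.Rank1Residual
  Literature.NumberTheory.EllipticCurves.Rank1Residual.Typed
  Literature.NumberTheory.EllipticCurves.Skinner2016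
  Literature.NumberTheory.EllipticCurves.Wuthrich2014
  Literature.NumberTheory.EllipticCurves.SteinWuthrich2013
  Literature.NumberTheory.EllipticCurves.EmertonPollackWeston2006

namespace Summit.BirchSwinnertonDyer.Rank1Residual.RankZeroHeightFree

/-! ### Skinner 2016 Thm. A on the (ram) locus ⇒ the rank-`0` half of Thm. C, height-free -/

/-- **Rank `0`, non-split multiplicative `p ≥ 3`, (irr) + (ram): `BSD(E,p)` from Skinner 2016
Thm. A (`hA`, PUBLISHED) composed with the rank-`0` glue** — i.e. the multiplicative half of the
conclusion of Skinner's Thm. C (tree: the separate named fact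
`Skinner2016.thmC_padicValRat_bsd_rank_zero`), here DERIVED in the kernel from Thm. A +
Stein–Wuthrich Thm. 6.1 + the interpolation property (consistency check; no certificate, `p ∣ #Ш_an`
allowed). Data: Tate parameter, cyclotomic data, newform, dual datum, period ratio, THE non-split
`p`-adic `L`-function. NOT an X11 theorem ((ram) is the complement of X11's rank-`0` clause).
[cite: Skinner2016PacificMC, Thm. A (§1), §3.2, §3.3, Thm. C] [cite: SteinWuthrich2013, Thm. 6.1 (p. 20)]
[cite: MazurTateTeitelbaum1986, §I.14] -/
theorem bsdp_of_thmA_nonsplit_rankZero_heightFree (hA : thmA_charIdeal_multiplicative)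
    (hJ : thm61_nonsplitMultiplicative)
    (hGZK : rank_eq_analyticRank_of_analyticRank_le_one) (hmod : hasEntireLFunction_rat)
    (W : WeierstrassCurve ℚ) [W.IsElliptic] [W.IsGloballyMinimal] (p : ℕ) [Fact p.Prime]
    {κ : ZpExtension ℚ p} {γ : Field.absoluteGaloisGroup ℚ} {N : ℕ} [NeZero N]
    {f : CuspForm (Gamma0 N) 2} (hp : 3 ≤ p) (hr : W.analyticRank = 0)
    (hmult : W.HasMultiplicativeReductionAtPrime p)
    (hns : ¬ W.HasSplitMultiplicativeReductionAtPrime p) (hirr : W.HasIrreducibleModPGaloisRep p)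
    (hram : Ram W p) {q : ℚ_[p]} (hq0 : q ≠ 0) (hq1 : ‖q‖ < 1) (hqj : tateJ q = (W.j : ℚ_[p]))
    (hκ : κ.IsCyclotomic) (hγ : κ.IsTopGenerator γ) (hγ' : IsCyclotomicVariable p γ)
    (hf : IsNewformOf W f) (D : W.SelmerDualData κ γ) (ϖ : ℚ) (hϖ0 : ϖ ≠ 0)
    (hϖ : (ϖ : ℝ) * W.realPeriodRat = plusPeriod f)
    (L : PowerSeries ℚ_[p]) (hL : IsMultPAdicLFunctionOf f p (-1) L) : BSDp W p := by
  refine bsdp_of_multCharIdeal_nonsplit_rankZero_heightFree hJ hGZK hmod W p (by omega) hr hmult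
      hns hq0 hq1
    hqj hκ hγ hγ' hf D ϖ hϖ0 hϖ L hL ?_
  obtain ⟨htors, g, hchar, -, hnsp⟩ := hA W p hp hmult hirr hram hκ hγ hγ' hf D ϖ hϖ0 hϖ
  obtain ⟨w, hw⟩ := hnsp hns L hL
  exact ⟨htors, g, w, hchar, hw⟩

/-- **Rank `0`, split multiplicative `p ≥ 3`, (irr) + (ram): `BSD(E,p)` from Skinner 2016 Thm. A
(`hA`) composed with the rank-`0` glue** (Stein–Wuthrich Thm. 6.1, Greenberg–Stevens, `𝓛_p ≠ 0`) —
the split-multiplicative half of Thm. C's conclusion, DERIVED. No certificate; `p ∣ #Ш_an` allowed.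
NOT an X11 theorem. [cite: Skinner2016PacificMC, Thm. A (§1), §3.2, §3.3, Thm. C]
[cite: SteinWuthrich2013, Thm. 6.1 (p. 20)] [cite: GreenbergStevens1993, Thm. (trivial zero)] -/
theorem bsdp_of_thmA_split_rankZero_heightFree (hA : thmA_charIdeal_multiplicative)
    (hJ : thm61_splitMultiplicative)
    (hGZK : rank_eq_analyticRank_of_analyticRank_le_one) (hmod : hasEntireLFunction_rat)
    (W : WeierstrassCurve ℚ) [W.IsElliptic] [W.IsGloballyMinimal] (p : ℕ) [Fact p.Prime]
    (hGS : greenberg_stevens (W := W) (p := p)) (h𝓛 : LInvariant_ne_zero (W := W) (p := p))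
    {κ : ZpExtension ℚ p} {γ : Field.absoluteGaloisGroup ℚ} {N : ℕ} [NeZero N]
    {f : CuspForm (Gamma0 N) 2} (hp : 3 ≤ p) (hr : W.analyticRank = 0)
    (hirr : W.HasIrreducibleModPGaloisRep p) (hram : Ram W p) (Dq : TateParameterData W p)
    (hκ : κ.IsCyclotomic) (hγ : κ.IsTopGenerator γ) (hγ' : IsCyclotomicVariable p γ)
    (hf : IsNewformOf W f) (D : W.SelmerDualData κ γ) (ϖ : ℚ) (hϖ0 : ϖ ≠ 0)
    (hϖ : (ϖ : ℝ) * W.realPeriodRat = plusPeriod f)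
    (L : PowerSeries ℚ_[p]) (hL : IsSplitMultPAdicLFunctionOf f p L) : BSDp W p := by
  refine bsdp_of_multCharIdeal_split_rankZero_heightFree hJ hGZK hmod W p hGS h𝓛 (by omega) hr Dq
      hκ hγ hγ'
    hf D ϖ hϖ0 hϖ L hL ?_
  obtain ⟨htors, g, hchar, hsp, -⟩ :=
    hA W p hp Dq.split.hasMultiplicativeReductionAtPrime hirr hram hκ hγ hγ' hf D ϖ hϖ0 hϖ
  obtain ⟨w, hw⟩ := hsp Dq.split L hL
  exact ⟨htors, g, w, hchar, hw⟩

section HidaTransfer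

variable (W : WeierstrassCurve ℚ) [W.IsElliptic] [W.IsGloballyMinimal] (p : ℕ) [Fact p.Prime]

/-! ### X11, rank `0`: `BSD(E,p)` from the multiplicative main-conjecture shape for `(E, p)` itself -/

/-- **X11 ∧ `r = 0`, NON-split `p ≠ 2`: `BSD(E,p)` from the integral main-conjecture identity with
`μ = 0` for `(E, p)` (`hMC : MultiplicativeCharIdealMuZero W p`, the conclusion shape of the
Emerton–Pollack–Weston transfer and of Skinner's Thm. A) — no numerical certificate, `p ∣ #Ш_an`
allowed, surjectivity of `ρ̄` not needed.** `ClassX11 W p` supplies multiplicative reduction; the rest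
is `bsdp_of_multCharIdeal_nonsplit_rankZero_heightFree` (Stein–Wuthrich Thm. 6.1 `hJ`, GZK,
modularity; the height-existence binder `hH` of the original is discharged — zero datum). Data: Tate parameter, cyclotomic data, newform, dual datum, period ratio, THE
non-split `p`-adic `L`-function. Per pair (the identity `hMC` is the input); NOT a deletion of X11.
[cite: EmertonPollackWeston2006, Cor. 5.1.4 (arXiv:math/0404484 p. 30)]
[cite: SteinWuthrich2013, Thm. 6.1 (p. 20) and §4.2] [cite: Miller2011LMS, Def. 1.1 and §1] -/
theorem X11RankZero.bsdp_of_multCharIdealMuZero_nonsplit_heightFree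
    (hJ : thm61_nonsplitMultiplicative)
    (hGZK : rank_eq_analyticRank_of_analyticRank_le_one)
    (hmod : hasEntireLFunction_rat)
    {κ : ZpExtension ℚ p} {γ : Field.absoluteGaloisGroup ℚ} {N : ℕ} [NeZero N]
    {f : CuspForm (Gamma0 N) 2} (hp : p ≠ 2) (hr : W.analyticRank = 0) (hX : ClassX11 W p)
    (hns : ¬ W.HasSplitMultiplicativeReductionAtPrime p) (hMC : MultiplicativeCharIdealMuZero W p)
    {q : ℚ_[p]} (hq0 : q ≠ 0) (hq1 : ‖q‖ < 1) (hqj : tateJ q = (W.j : ℚ_[p]))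
    (hκ : κ.IsCyclotomic) (hγ : κ.IsTopGenerator γ) (hγ' : IsCyclotomicVariable p γ)
    (hf : IsNewformOf W f) (D : W.SelmerDualData κ γ) (ϖ : ℚ) (hϖ0 : ϖ ≠ 0)
    (hϖ : (ϖ : ℝ) * W.realPeriodRat = plusPeriod f)
    (L : PowerSeries ℚ_[p]) (hL : IsMultPAdicLFunctionOf f p (-1) L) : BSDp W p := by
  refine bsdp_of_multCharIdeal_nonsplit_rankZero_heightFree hJ hGZK hmod W p hp hr hX.mult hns hq0
      hq1 hqj hκ
    hγ hγ' hf D ϖ hϖ0 hϖ L hL ?_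
  obtain ⟨fE, w, hchar, -, hw⟩ :=
    hMC.exists_charIdeal_eq_unit_nonsplit hκ hγ hγ' hf D ϖ hϖ0 hϖ hns L hL
  exact ⟨hMC.isTorsion hκ hγ hγ' hf D ϖ hϖ0 hϖ, fE, w, hchar, hw⟩

/-- **X11 ∧ `r = 0`, SPLIT `p ≠ 2`: `BSD(E,p)` from the integral main-conjecture identity with
`μ = 0` for `(E, p)`** — `bsdp_of_multCharIdeal_split_rankZero` (Stein–Wuthrich Thm. 6.1 `hJ`, height
existence discharged, Greenberg–Stevens `hGS`, `𝓛_p ≠ 0` `h𝓛`, GZK, modularity). Per pair.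
[cite: EmertonPollackWeston2006, Cor. 5.1.4 (arXiv:math/0404484 p. 30)]
[cite: SteinWuthrich2013, Thm. 6.1 (p. 20) and §4.2] [cite: GreenbergStevens1993, Thm. (trivial zero)]
[cite: Miller2011LMS, Def. 1.1 and §1] -/
theorem X11RankZero.bsdp_of_multCharIdealMuZero_split_heightFree (hJ : thm61_splitMultiplicative)
    (hGZK : rank_eq_analyticRank_of_analyticRank_le_one)
    (hmod : hasEntireLFunction_rat)
    (hGS : greenberg_stevens (W := W) (p := p)) (h𝓛 : LInvariant_ne_zero (W := W) (p := p))
    {κ : ZpExtension ℚ p} {γ : Field.absoluteGaloisGroup ℚ} {N : ℕ} [NeZero N]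
    {f : CuspForm (Gamma0 N) 2} (hp : p ≠ 2) (hr : W.analyticRank = 0) (_hX : ClassX11 W p)
    (hMC : MultiplicativeCharIdealMuZero W p) (Dq : TateParameterData W p)
    (hκ : κ.IsCyclotomic) (hγ : κ.IsTopGenerator γ) (hγ' : IsCyclotomicVariable p γ)
    (hf : IsNewformOf W f) (D : W.SelmerDualData κ γ) (ϖ : ℚ) (hϖ0 : ϖ ≠ 0)
    (hϖ : (ϖ : ℝ) * W.realPeriodRat = plusPeriod f)
    (L : PowerSeries ℚ_[p]) (hL : IsSplitMultPAdicLFunctionOf f p L) : BSDp W p := by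
  refine bsdp_of_multCharIdeal_split_rankZero_heightFree hJ hGZK hmod W p hGS h𝓛 hp hr Dq hκ hγ
      hγ' hf D ϖ
    hϖ0 hϖ L hL ?_
  obtain ⟨fE, w, hchar, -, hw⟩ :=
    hMC.exists_charIdeal_eq_unit_split hκ hγ hγ' hf D ϖ hϖ0 hϖ Dq.split L hL
  exact ⟨hMC.isTorsion hκ hγ hγ' hf D ϖ hϖ0 hϖ, fE, w, hchar, hw⟩

/-! ### The typed rank-zero input of `Typed/X11.lean` is DISCHARGED by the shape -/

/-- **X11 ∧ `r = 0`, non-split `p ≠ 2`: the typed missing input `X11RankZero.MissingInputAt W p`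
HOLDS as soon as the multiplicative main-conjecture shape holds for `(E, p)`** (from `BSD(E,p)`,
`missingPPartAt_of_bsdp`, `X11RankZero.missingInputAt_of_missingPPartAt`). Bookkeeping: this is the
sense in which the LAST class-level residue of X11 at `p ≥ 5` is "reached" by the Hida-family
transfer. [cite: EmertonPollackWeston2006, Cor. 5.1.4 (arXiv:math/0404484 p. 30)]
[cite: Miller2011LMS, Def. 1.1] -/
theorem X11RankZero.missingInputAt_of_multCharIdealMuZero_nonsplit_heightFree
    (hJ : thm61_nonsplitMultiplicative)
    (hGZK : rank_eq_analyticRank_of_analyticRank_le_one)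
    (hmod : hasEntireLFunction_rat)
    {κ : ZpExtension ℚ p} {γ : Field.absoluteGaloisGroup ℚ} {N : ℕ} [NeZero N]
    {f : CuspForm (Gamma0 N) 2} (hp : p ≠ 2) (hr : W.analyticRank = 0) (hX : ClassX11 W p)
    (hns : ¬ W.HasSplitMultiplicativeReductionAtPrime p) (hMC : MultiplicativeCharIdealMuZero W p)
    {q : ℚ_[p]} (hq0 : q ≠ 0) (hq1 : ‖q‖ < 1) (hqj : tateJ q = (W.j : ℚ_[p]))
    (hκ : κ.IsCyclotomic) (hγ : κ.IsTopGenerator γ) (hγ' : IsCyclotomicVariable p γ)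
    (hf : IsNewformOf W f) (D : W.SelmerDualData κ γ) (ϖ : ℚ) (hϖ0 : ϖ ≠ 0)
    (hϖ : (ϖ : ℝ) * W.realPeriodRat = plusPeriod f)
    (L : PowerSeries ℚ_[p]) (hL : IsMultPAdicLFunctionOf f p (-1) L) :
    X11RankZero.MissingInputAt W p := by
  haveI : Finite W.sha := (hGZK W (by omega)).2
  exact X11RankZero.missingInputAt_of_missingPPartAt
    (missingPPartAt_of_bsdp W p
      (X11RankZero.bsdp_of_multCharIdealMuZero_nonsplit_heightFree W p hJ hGZK hmod hp hr hX hns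
        hMC hq0 hq1 hqj
        hκ hγ hγ' hf D ϖ hϖ0 hϖ L hL))

/-- **X11 ∧ `r = 0`, split `p ≠ 2`: the typed missing input HOLDS given the shape** (as above).
[cite: EmertonPollackWeston2006, Cor. 5.1.4 (arXiv:math/0404484 p. 30)] [cite: Miller2011LMS, Def. 1.1] -/
theorem X11RankZero.missingInputAt_of_multCharIdealMuZero_split_heightFree
    (hJ : thm61_splitMultiplicative)
    (hGZK : rank_eq_analyticRank_of_analyticRank_le_one)
    (hmod : hasEntireLFunction_rat)
    (hGS : greenberg_stevens (W := W) (p := p)) (h𝓛 : LInvariant_ne_zero (W := W) (p := p))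
    {κ : ZpExtension ℚ p} {γ : Field.absoluteGaloisGroup ℚ} {N : ℕ} [NeZero N]
    {f : CuspForm (Gamma0 N) 2} (hp : p ≠ 2) (hr : W.analyticRank = 0) (hX : ClassX11 W p)
    (hMC : MultiplicativeCharIdealMuZero W p) (Dq : TateParameterData W p)
    (hκ : κ.IsCyclotomic) (hγ : κ.IsTopGenerator γ) (hγ' : IsCyclotomicVariable p γ)
    (hf : IsNewformOf W f) (D : W.SelmerDualData κ γ) (ϖ : ℚ) (hϖ0 : ϖ ≠ 0)
    (hϖ : (ϖ : ℝ) * W.realPeriodRat = plusPeriod f)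
    (L : PowerSeries ℚ_[p]) (hL : IsSplitMultPAdicLFunctionOf f p L) :
    X11RankZero.MissingInputAt W p := by
  haveI : Finite W.sha := (hGZK W (by omega)).2
  exact X11RankZero.missingInputAt_of_missingPPartAt
    (missingPPartAt_of_bsdp W p
      (X11RankZero.bsdp_of_multCharIdealMuZero_split_heightFree W p hJ hGZK hmod hGS h𝓛 hp hr hX
        hMC Dq hκ hγ
        hγ' hf D ϖ hϖ0 hϖ L hL))

/-! ### Partner-explicit forms (the two named facts of Emerton–Pollack–Weston) -/

/-- **X11 ∧ `r = 0` (hence `¬ram(p)` at `p ≥ 5`), non-split `p ≥ 5`, GOOD-ORDINARY partner: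
`BSD(E,p)` from PUBLISHED facts plus the per-pair inputs [a globally minimal `E₁` good ordinary at
`p`, a `Γ_ℚ`-isomorphism `E₁[p] ≃ E[p]`, `E₁[p]` irreducible, and the integral main-conjecture
identity with `μ = 0` for `(E₁, p)` (`h₁`)].** Emerton–Pollack–Weston Cor. 5.1.4 (`hEPW`) moves
`h₁` to `(E, p)`; then `X11RankZero.bsdp_of_multCharIdealMuZero_nonsplit`. The partner exists only
if `E[p]` is finite at `p` (`p ∣ v_p(Δ_min)`); nothing is closed by this theorem until a partner and
`h₁` are certified (lane). [cite: EmertonPollackWeston2006, Cor. 5.1.4 and Thm. 5.1.3 (arXiv p. 30)]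
[cite: SteinWuthrich2013, Thm. 6.1 (p. 20)] [cite: Miller2011LMS, Def. 1.1 and §1] -/
theorem X11RankZero.bsdp_of_transfer_goodOrdinary_nonsplit_heightFree
    (hEPW : cor514_transfer_of_goodOrdinary)
    (hJ : thm61_nonsplitMultiplicative)
    (hGZK : rank_eq_analyticRank_of_analyticRank_le_one) (hmod : hasEntireLFunction_rat)
    (W₁ : WeierstrassCurve ℚ) [W₁.IsElliptic] [W₁.IsGloballyMinimal]
    {κ : ZpExtension ℚ p} {γ : Field.absoluteGaloisGroup ℚ} {N : ℕ} [NeZero N]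
    {f : CuspForm (Gamma0 N) 2} (hp : 5 ≤ p) (hr : W.analyticRank = 0) (hX : ClassX11 W p)
    (hns : ¬ W.HasSplitMultiplicativeReductionAtPrime p)
    (hgood₁ : W₁.HasGoodReductionAtPrime p) (hord₁ : ¬ (p : ℤ) ∣ W₁.frobeniusTrace p)
    (hiso : ∃ e : geomTorsion W₁ (p : ℤ) ≃+ geomTorsion W (p : ℤ),
      ∀ (σ : Field.absoluteGaloisGroup ℚ) (P : geomTorsion W₁ (p : ℤ)), e (σ • P) = σ • e P)
    (hirr₁ : W₁.HasIrreducibleModPGaloisRep p) (h₁ : GoodOrdinaryCharIdealMuZero W₁ p)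
    {q : ℚ_[p]} (hq0 : q ≠ 0) (hq1 : ‖q‖ < 1) (hqj : tateJ q = (W.j : ℚ_[p]))
    (hκ : κ.IsCyclotomic) (hγ : κ.IsTopGenerator γ) (hγ' : IsCyclotomicVariable p γ)
    (hf : IsNewformOf W f) (D : W.SelmerDualData κ γ) (ϖ : ℚ) (hϖ0 : ϖ ≠ 0)
    (hϖ : (ϖ : ℝ) * W.realPeriodRat = plusPeriod f)
    (L : PowerSeries ℚ_[p]) (hL : IsMultPAdicLFunctionOf f p (-1) L) : BSDp W p :=
  X11RankZero.bsdp_of_multCharIdealMuZero_nonsplit_heightFree W p hJ hGZK hmod (by omega) hr hX hns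
    (hEPW W₁ W p hp hgood₁ hord₁ hX.mult hiso hirr₁ h₁) hq0 hq1 hqj hκ hγ hγ' hf D ϖ hϖ0 hϖ L hL

/-- **X11 ∧ `r = 0`, split `p ≥ 5`, GOOD-ORDINARY partner**: as the non-split case, through
`X11RankZero.bsdp_of_multCharIdealMuZero_split` (Greenberg–Stevens, `𝓛_p ≠ 0`).
[cite: EmertonPollackWeston2006, Cor. 5.1.4 and Thm. 5.1.3 (arXiv p. 30)]
[cite: SteinWuthrich2013, Thm. 6.1 (p. 20)] [cite: GreenbergStevens1993, Thm. (trivial zero)] -/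
theorem X11RankZero.bsdp_of_transfer_goodOrdinary_split_heightFree
    (hEPW : cor514_transfer_of_goodOrdinary)
    (hJ : thm61_splitMultiplicative)
    (hGZK : rank_eq_analyticRank_of_analyticRank_le_one) (hmod : hasEntireLFunction_rat)
    (hGS : greenberg_stevens (W := W) (p := p)) (h𝓛 : LInvariant_ne_zero (W := W) (p := p))
    (W₁ : WeierstrassCurve ℚ) [W₁.IsElliptic] [W₁.IsGloballyMinimal]
    {κ : ZpExtension ℚ p} {γ : Field.absoluteGaloisGroup ℚ} {N : ℕ} [NeZero N]
    {f : CuspForm (Gamma0 N) 2} (hp : 5 ≤ p) (hr : W.analyticRank = 0) (hX : ClassX11 W p)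
    (hgood₁ : W₁.HasGoodReductionAtPrime p) (hord₁ : ¬ (p : ℤ) ∣ W₁.frobeniusTrace p)
    (hiso : ∃ e : geomTorsion W₁ (p : ℤ) ≃+ geomTorsion W (p : ℤ),
      ∀ (σ : Field.absoluteGaloisGroup ℚ) (P : geomTorsion W₁ (p : ℤ)), e (σ • P) = σ • e P)
    (hirr₁ : W₁.HasIrreducibleModPGaloisRep p) (h₁ : GoodOrdinaryCharIdealMuZero W₁ p)
    (Dq : TateParameterData W p)
    (hκ : κ.IsCyclotomic) (hγ : κ.IsTopGenerator γ) (hγ' : IsCyclotomicVariable p γ)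
    (hf : IsNewformOf W f) (D : W.SelmerDualData κ γ) (ϖ : ℚ) (hϖ0 : ϖ ≠ 0)
    (hϖ : (ϖ : ℝ) * W.realPeriodRat = plusPeriod f)
    (L : PowerSeries ℚ_[p]) (hL : IsSplitMultPAdicLFunctionOf f p L) : BSDp W p :=
  X11RankZero.bsdp_of_multCharIdealMuZero_split_heightFree W p hJ hGZK hmod hGS h𝓛 (by omega) hr hX
    (hEPW W₁ W p hp hgood₁ hord₁ hX.mult hiso hirr₁ h₁) Dq hκ hγ hγ' hf D ϖ hϖ0 hϖ L hL

/-- **X11 ∧ `r = 0`, non-split `p ≥ 5`, MULTIPLICATIVE partner** (`E₁` multiplicative at `p` with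
the multiplicative shape `h₁ : MultiplicativeCharIdealMuZero W₁ p` — e.g. a (ram) curve through
Skinner's Thm. A and the certificate "`μ^an = 0`", `multiplicativeCharIdealMuZero_of_thmA`; NOTE
(R32.4 wording): "`ρ̄` ramified at `q`" is a `ρ̄`-property and "`q ‖ N_{E₁}`" a property of the partner,
but for elliptic curves at `p ≥ 5` (ram) as a whole is a `ρ̄`-invariant, so a (ram) partner of a `¬ram`
curve does not exist: this form serves a partner whose identity is known otherwise). [cite: EmertonPollackWeston2006, Cor. 5.1.4 and Thm. 5.1.3 (arXiv p. 30)]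
[cite: SteinWuthrich2013, Thm. 6.1 (p. 20)] [cite: Miller2011LMS, Def. 1.1 and §1] -/
theorem X11RankZero.bsdp_of_transfer_multiplicative_nonsplit_heightFree
    (hEPW : cor514_transfer_of_multiplicative)
    (hJ : thm61_nonsplitMultiplicative)
    (hGZK : rank_eq_analyticRank_of_analyticRank_le_one) (hmod : hasEntireLFunction_rat)
    (W₁ : WeierstrassCurve ℚ) [W₁.IsElliptic] [W₁.IsGloballyMinimal]
    {κ : ZpExtension ℚ p} {γ : Field.absoluteGaloisGroup ℚ} {N : ℕ} [NeZero N]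
    {f : CuspForm (Gamma0 N) 2} (hp : 5 ≤ p) (hr : W.analyticRank = 0) (hX : ClassX11 W p)
    (hns : ¬ W.HasSplitMultiplicativeReductionAtPrime p)
    (hmult₁ : W₁.HasMultiplicativeReductionAtPrime p)
    (hiso : ∃ e : geomTorsion W₁ (p : ℤ) ≃+ geomTorsion W (p : ℤ),
      ∀ (σ : Field.absoluteGaloisGroup ℚ) (P : geomTorsion W₁ (p : ℤ)), e (σ • P) = σ • e P)
    (hirr₁ : W₁.HasIrreducibleModPGaloisRep p) (h₁ : MultiplicativeCharIdealMuZero W₁ p)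
    {q : ℚ_[p]} (hq0 : q ≠ 0) (hq1 : ‖q‖ < 1) (hqj : tateJ q = (W.j : ℚ_[p]))
    (hκ : κ.IsCyclotomic) (hγ : κ.IsTopGenerator γ) (hγ' : IsCyclotomicVariable p γ)
    (hf : IsNewformOf W f) (D : W.SelmerDualData κ γ) (ϖ : ℚ) (hϖ0 : ϖ ≠ 0)
    (hϖ : (ϖ : ℝ) * W.realPeriodRat = plusPeriod f)
    (L : PowerSeries ℚ_[p]) (hL : IsMultPAdicLFunctionOf f p (-1) L) : BSDp W p :=
  X11RankZero.bsdp_of_multCharIdealMuZero_nonsplit_heightFree W p hJ hGZK hmod (by omega) hr hX hns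
    (hEPW W₁ W p hp hmult₁ hX.mult hiso hirr₁ h₁) hq0 hq1 hqj hκ hγ hγ' hf D ϖ hϖ0 hϖ L hL

/-- **X11 ∧ `r = 0`, split `p ≥ 5`, MULTIPLICATIVE partner**: as above, through
`X11RankZero.bsdp_of_multCharIdealMuZero_split`. [cite: EmertonPollackWeston2006, Cor. 5.1.4 and Thm. 5.1.3 (arXiv p. 30)]
[cite: SteinWuthrich2013, Thm. 6.1 (p. 20)] [cite: GreenbergStevens1993, Thm. (trivial zero)] -/
theorem X11RankZero.bsdp_of_transfer_multiplicative_split_heightFree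
    (hEPW : cor514_transfer_of_multiplicative)
    (hJ : thm61_splitMultiplicative)
    (hGZK : rank_eq_analyticRank_of_analyticRank_le_one) (hmod : hasEntireLFunction_rat)
    (hGS : greenberg_stevens (W := W) (p := p)) (h𝓛 : LInvariant_ne_zero (W := W) (p := p))
    (W₁ : WeierstrassCurve ℚ) [W₁.IsElliptic] [W₁.IsGloballyMinimal]
    {κ : ZpExtension ℚ p} {γ : Field.absoluteGaloisGroup ℚ} {N : ℕ} [NeZero N]
    {f : CuspForm (Gamma0 N) 2} (hp : 5 ≤ p) (hr : W.analyticRank = 0) (hX : ClassX11 W p)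
    (hmult₁ : W₁.HasMultiplicativeReductionAtPrime p)
    (hiso : ∃ e : geomTorsion W₁ (p : ℤ) ≃+ geomTorsion W (p : ℤ),
      ∀ (σ : Field.absoluteGaloisGroup ℚ) (P : geomTorsion W₁ (p : ℤ)), e (σ • P) = σ • e P)
    (hirr₁ : W₁.HasIrreducibleModPGaloisRep p) (h₁ : MultiplicativeCharIdealMuZero W₁ p)
    (Dq : TateParameterData W p)
    (hκ : κ.IsCyclotomic) (hγ : κ.IsTopGenerator γ) (hγ' : IsCyclotomicVariable p γ)
    (hf : IsNewformOf W f) (D : W.SelmerDualData κ γ) (ϖ : ℚ) (hϖ0 : ϖ ≠ 0)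
    (hϖ : (ϖ : ℝ) * W.realPeriodRat = plusPeriod f)
    (L : PowerSeries ℚ_[p]) (hL : IsSplitMultPAdicLFunctionOf f p L) : BSDp W p :=
  X11RankZero.bsdp_of_multCharIdealMuZero_split_heightFree W p hJ hGZK hmod hGS h𝓛 (by omega) hr hX
    (hEPW W₁ W p hp hmult₁ Dq.split.hasMultiplicativeReductionAtPrime hiso hirr₁ h₁) Dq hκ hγ hγ'
        hf D
    ϖ hϖ0 hϖ L hL

end HidaTransfer

end Summit.BirchSwinnertonDyer.Rank1Residual.RankZeroHeightFree

end
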